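import Mathlib.Data.Finset.Max
import Mathlib.Order.Interval.Finset.Nat
import Mathlib.Data.Nat.Find
import Mathlib.Data.Finset.Prod
import HarnessLib

/-!
# The staircase and the boundary filters of a pair of up-sets (PATH LEMMA of hub-Kleitman, memo §1.1–1.3: U ↦ R, 𝒟 ↦ P, Q)

Support file (`--supports stmt-CriticalPhenomena-4575`, closed), prover `prim-cplus-coupling` (gen 51).  No definitions, no notations,
no named facts, no sorries; standard axioms.  Memo `prim-cplus-coupling/A5-COUPLING-gen51.md` §1.1–§1.3, §1.6.

From an up-set `𝒴` of vertex-index sets of the path `w₀ … w_ℓ` (a monotone predicate `Y` with `[0, ℓ] ∈ 𝒴`):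
* `hubPath_staircase` — the STAIRCASE `om x = max {y ≤ ℓ : [0, x] ∪ [y, ℓ] ∈ 𝒴}`: `x + 1 ≤ om x ≤ ℓ`, nondecreasing, and
  `y ≤ om x ↔ [0, x] ∪ [y, ℓ] ∈ 𝒴` (memo §1.3: `ω(m) = n + 1 - φ(m)`; the BB sources / RR targets are the cells of `R = {y ≤ om x}`);
* `hubPath_filters` — from an antitone `P` and a monotone `Q` on cells (memo §1.3: `P = [x ≤ p₁ ∧ y ≤ p₂]`, `Q = [x ≥ q₁ ∧ y ≥ q₂]`, here as
  predicates) the finite cell sets `A = P ∖ Q` (down-closed) and `B = Q ∖ P` (up-closed), inside the staircase, disjoint — the data of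
  `…KernelMixHubClosed.hubStair_matching_closed` / `…KernelMixHubPathCore.hubPath_core`.
[cite: KozmaNitzan2024, Questions 8–9 (§5.5 p. 36) (context)]
-/

namespace Summit.CriticalPhenomena.PercolationContinuityZ3.Theorems

open Finset

namespace Coefficientwise

/-- **The staircase of an up-set** (memo §1.3): `om x = max {y ≤ ℓ : [0,x] ∪ [y,ℓ] ∈ 𝒴}`. [folklore] -/
theorem hubPath_staircase (ℓ : ℕ) (Y : Finset ℕ → Prop) (hYmono : ∀ S T : Finset ℕ, S ⊆ T → Y S → Y T)
    (hY1 : Y (Icc 0 ℓ)) :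
    ∃ om : ℕ → ℕ, (∀ x, 1 ≤ x → x ≤ ℓ - 1 → x + 1 ≤ om x ∧ om x ≤ ℓ) ∧
      (∀ x y, 1 ≤ x → x ≤ y → y ≤ ℓ - 1 → om x ≤ om y) ∧
      (∀ x y, x + 1 ≤ ℓ → y ≤ ℓ → (y ≤ om x ↔ Y (Icc 0 x ∪ Icc y ℓ))) := by
  classical
  obtain ⟨om, hom⟩ : ∃ om : ℕ → ℕ, ∀ x, om x = Nat.findGreatest (fun y => Y (Icc 0 x ∪ Icc y ℓ)) ℓ :=
    ⟨_, fun _ => rfl⟩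
  have homle : ∀ x, om x ≤ ℓ := fun x => by rw [hom]; exact Nat.findGreatest_le _
  have hfull : ∀ x y, y ≤ x + 1 → Icc 0 ℓ ⊆ Icc 0 x ∪ Icc y ℓ := by
    intro x y hxy k hk
    rw [Finset.mem_union, Finset.mem_Icc, Finset.mem_Icc]
    have := (Finset.mem_Icc.mp hk).2
    by_cases hkx : k ≤ x
    · exact Or.inl ⟨Nat.zero_le _, hkx⟩
    · exact Or.inr ⟨by omega, this⟩
  have homge : ∀ x, x + 1 ≤ ℓ → x + 1 ≤ om x := by
    intro x hx
    rw [hom]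
    exact Nat.le_findGreatest (P := fun y => Y (Icc 0 x ∪ Icc y ℓ)) hx
      (hYmono _ _ (hfull x (x + 1) (le_refl _)) hY1)
  have homY : ∀ x y, x + 1 ≤ ℓ → y ≤ ℓ → (y ≤ om x ↔ Y (Icc 0 x ∪ Icc y ℓ)) := by
    intro x y hx hy
    constructor
    · intro h
      have hspec : Y (Icc 0 x ∪ Icc (om x) ℓ) := by
        rw [hom]
        exact Nat.findGreatest_spec (P := fun y => Y (Icc 0 x ∪ Icc y ℓ)) hx
          (hYmono _ _ (hfull x (x + 1) (le_refl _)) hY1)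
      refine hYmono _ _ ?_ hspec
      exact Finset.union_subset_union (Finset.Subset.refl _) (Finset.Icc_subset_Icc_left h)
    · intro h
      rw [hom]
      exact Nat.le_findGreatest (P := fun y => Y (Icc 0 x ∪ Icc y ℓ)) hy h
  refine ⟨om, fun x _ hx => ⟨homge x (by omega), homle x⟩, ?_, homY⟩
  intro x y _ hxy hy
  have h1 := (homY x (om x) (by omega) (homle x)).mp (le_refl _)
  refine (homY y (om x) (by omega) (homle x)).mpr (hYmono _ _ ?_ h1)
  exact Finset.union_subset_union (Finset.Icc_subset_Icc_right hxy) (Finset.Subset.refl _)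

/-- **The boundary filters** (memo §1.3/§1.6): `A = P ∖ Q` down-closed, `B = Q ∖ P` up-closed, finite cell sets inside the staircase,
disjoint. [folklore] -/
theorem hubPath_filters (ℓ : ℕ) (om : ℕ → ℕ) (Y : Finset ℕ → Prop) (hYmono : ∀ S T : Finset ℕ, S ⊆ T → Y S → Y T)
    (homY : ∀ x y, x + 1 ≤ ℓ → y ≤ ℓ → (y ≤ om x ↔ Y (Icc 0 x ∪ Icc y ℓ)))
    (P Q : ℕ → ℕ → Prop) (hPanti : ∀ x y x' y', x' ≤ x → y' ≤ y → P x y → P x' y')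
    (hQmono : ∀ x y x' y', x ≤ x' → y ≤ y' → y' ≤ ℓ → Q x y → Q x' y')
    (hPY : ∀ x y, P x y → Y (Icc 0 0 ∪ Icc y ℓ)) (hQY : ∀ x y, Q x y → Y (Icc 0 x ∪ Icc ℓ ℓ)) :
    ∃ A B : Finset (ℕ × ℕ),
      (∀ x y, (x, y) ∈ A ↔ 1 ≤ x ∧ x ≤ y ∧ y ≤ ℓ - 1 ∧ P x y ∧ ¬ Q x y) ∧
      (∀ x y, (x, y) ∈ B ↔ 1 ≤ x ∧ x ≤ y ∧ y ≤ ℓ - 1 ∧ Q x y ∧ ¬ P x y) ∧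
      (∀ c ∈ A, 1 ≤ c.1 ∧ c.1 ≤ c.2 ∧ c.2 ≤ ℓ - 1 ∧ c.2 ≤ om c.1) ∧
      (∀ c ∈ A, ∀ x y, 1 ≤ x → x ≤ c.1 → x ≤ y → y ≤ c.2 → (x, y) ∈ A) ∧
      (∀ c ∈ B, 1 ≤ c.1 ∧ c.1 ≤ c.2 ∧ c.2 ≤ ℓ - 1 ∧ c.2 ≤ om c.1) ∧
      (∀ c ∈ B, ∀ x y, c.1 ≤ x → c.2 ≤ y → x ≤ y → y ≤ ℓ - 1 → (x, y) ∈ B) ∧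
      (∀ c ∈ A, c ∉ B) := by
  classical
  obtain ⟨A, hA⟩ : ∃ A : Finset (ℕ × ℕ), A = ((Icc 1 (ℓ - 1)) ×ˢ (Icc 1 (ℓ - 1))).filter
      (fun c => c.1 ≤ c.2 ∧ P c.1 c.2 ∧ ¬ Q c.1 c.2) := ⟨_, rfl⟩
  obtain ⟨B, hB⟩ : ∃ B : Finset (ℕ × ℕ), B = ((Icc 1 (ℓ - 1)) ×ˢ (Icc 1 (ℓ - 1))).filter
      (fun c => c.1 ≤ c.2 ∧ Q c.1 c.2 ∧ ¬ P c.1 c.2) := ⟨_, rfl⟩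
  have hmemA : ∀ x y, (x, y) ∈ A ↔ 1 ≤ x ∧ x ≤ y ∧ y ≤ ℓ - 1 ∧ P x y ∧ ¬ Q x y := by
    intro x y
    rw [hA, Finset.mem_filter, Finset.mem_product, Finset.mem_Icc, Finset.mem_Icc]
    constructor
    · rintro ⟨⟨⟨h1, _⟩, ⟨_, h4⟩⟩, h5, h6, h7⟩; exact ⟨h1, h5, h4, h6, h7⟩
    · rintro ⟨h1, h2, h3, h4, h5⟩; exact ⟨⟨⟨h1, by omega⟩, ⟨by omega, h3⟩⟩, h2, h4, h5⟩
  have hmemB : ∀ x y, (x, y) ∈ B ↔ 1 ≤ x ∧ x ≤ y ∧ y ≤ ℓ - 1 ∧ Q x y ∧ ¬ P x y := by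
    intro x y
    rw [hB, Finset.mem_filter, Finset.mem_product, Finset.mem_Icc, Finset.mem_Icc]
    constructor
    · rintro ⟨⟨⟨h1, _⟩, ⟨_, h4⟩⟩, h5, h6, h7⟩; exact ⟨h1, h5, h4, h6, h7⟩
    · rintro ⟨h1, h2, h3, h4, h5⟩; exact ⟨⟨⟨h1, by omega⟩, ⟨by omega, h3⟩⟩, h2, h4, h5⟩
  refine ⟨A, B, hmemA, hmemB, ?_, ?_, ?_, ?_, ?_⟩
  · rintro ⟨x, y⟩ h
    obtain ⟨h1, h2, h3, hp, _⟩ := (hmemA x y).mp h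
    refine ⟨h1, h2, h3, (homY x y (by omega) (by omega)).mpr ?_⟩
    exact hYmono _ _ (Finset.union_subset_union (Finset.Icc_subset_Icc_right (Nat.zero_le _))
      (Finset.Subset.refl _)) (hPY x y hp)
  · rintro ⟨x₀, y₀⟩ h x y hx hxx hxy hyy
    obtain ⟨_, _, h3, hp, hq⟩ := (hmemA x₀ y₀).mp h
    exact (hmemA x y).mpr ⟨hx, hxy, by omega, hPanti _ _ _ _ hxx hyy hp,
      fun h' => hq (hQmono _ _ _ _ hxx hyy (by omega) h')⟩
  · rintro ⟨x, y⟩ h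
    obtain ⟨h1, h2, h3, hq, _⟩ := (hmemB x y).mp h
    refine ⟨h1, h2, h3, (homY x y (by omega) (by omega)).mpr ?_⟩
    exact hYmono _ _ (Finset.union_subset_union (Finset.Subset.refl _)
      (Finset.Icc_subset_Icc_left (by omega))) (hQY x y hq)
  · rintro ⟨x₀, y₀⟩ h x y hxx hyy hxy hy
    obtain ⟨h1, _, _, hq, hp⟩ := (hmemB x₀ y₀).mp h
    exact (hmemB x y).mpr ⟨by omega, hxy, hy, hQmono _ _ _ _ hxx hyy (by omega) hq,
      fun h' => hp (hPanti _ _ _ _ hxx hyy h')⟩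
  · rintro ⟨x, y⟩ h h'
    exact ((hmemA x y).mp h).2.2.2.2 ((hmemB x y).mp h').2.2.2.1

end Coefficientwise

end Summit.CriticalPhenomena.PercolationContinuityZ3.Theorems
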